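import Summits.HodgeConjecture.CorCM.IrreducibleOddWeightsShadowIdealsCriterion
import HarnessLib

/-!
# Shadow ideals, III: the Hecke algebra of a torsor — equivariant endomorphisms of `ℚ^Y` are combinations of the
# commuting translations, and the criterion becomes `span{w₀ ∘ q_σ} ∩ span{w₁ ∘ q_σ} = 0`

COR-CM (cell `pub-hodgecm2`, binder seat `b16` gen 63, count-neutral claim SHADOW IDEALS, file S3 — abstract `G`-set
level; theorems only, no definition, no named fact, no `sorry`).  NEW as stated, hence under `Summits/`.  HONEST FRAMING:
finite-dimensional linear algebra about the Kubota–Dodson rank of a pair of CM types (`Hg(A₀ × A₁)` versus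
`Hg(A₀) × Hg(A₁)`); `HC_CM` is neither used nor asserted.

SETTING of files S1/S2 (`IrreducibleOddWeightsShadowIdeals{,Criterion}`): a pivot `Y` (finite `G`-set), equivariant
surjections `r_κ : E_{i_κ} → Y`, shadows `w_κ = (r_κ)_* u_1(Φ_{i_κ})`; S2: the pair `{Φ_{i₀}, Φ_{i₁}}` is additive iff no
two `G`-equivariant endomorphisms of `ℚ^Y` collide `w₀` and `w₁`.  Here `Y` carries moreover a family of maps
`q_σ : Y → Y` (`σ ∈ Γ`) COMMUTING with `G`, injective, and COVERING: every `y` is moved to a base point `y₀` by some `q_σ`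
— for `Y = Hom(M, ℂ)` with `M` NORMAL: `q_δ(z) = z ∘ δ`, `δ ∈ Aut(M)` (pre-composition commutes with the post-composition
action of `Aut(ℂ)`, and `Aut(M)` is transitive on `Hom(M, ℂ)`).

* §1 **`exists_sum_precomp_of_commute`** (no group structure needed): if linear `α : ℚ^Y → ℚ^Y` commutes with an
  injective family `p_λ` moving every point to `y₀`, and `q_σ` is an injective family commuting with the `p_λ` and
  covering `Y` from `y₀`, then `α = Σ_y c_y · q_{τ_y}^*` is a combination of the pull-backs `f ↦ f ∘ q_τ`
  (`c = α(δ_{y₀})`; both sides agree on `δ_{y₀}`, hence on every `δ_y = δ_{y₀} ∘ p_λ`).  **`apply_mem_span_precomp`**: a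
  `G`-equivariant `α` has `α(f) ∈ span{f ∘ q_σ}` — the Hecke algebra `End_G(ℚ^Y)` of the torsor is spanned by the
  `q_σ^*`; conversely `exists_equivariant_of_mem_span_precomp`.
* §2 **`typeRank_sigmaType_add_card_lt_of_span_precomp_inf_ne_bot`** (only commutation of `q` with `G`): a non-zero
  common element of `span{w₀ ∘ q_σ}` and `span{w₁ ∘ q_σ}` obstructs additivity;
  **`typeRank_sigmaType_add_card_eq_iff_span_precomp_inf_eq_bot`** — THE HECKE CRITERION: under S1's (H1)–(H3) and the
  torsor hypotheses, `rank(Φ₀, Φ₁) + 2 = rank Φ₀ + rank Φ₁ + 1` (`Hg(A₀ × A₁) = Hg(A₀) × Hg(A₁)`) **iff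
  `span{w₀ ∘ q_σ : σ} ∩ span{w₁ ∘ q_σ : σ} = 0`** — in the group ring of `Γ ≅ Y` (base point `y₀`, `G` acting on the left):
  iff the RIGHT ideals `w₀ℚ[Γ]` and `w₁ℚ[Γ]` meet in `0`.  Nondegeneracy form.  (File S4
  `IrreducibleOddWeightsShadowIdealsCommutative`: for COMMUTING `q_σ` this is ORTHOGONALITY `Σ_y w₀(y) w₁(q_σ y) = 0 ∀σ`;
  file S5 `…CMFields`: the CM dress.)

## References

* [Gordon1999HodgeAVSurvey] B. B. Gordon, *A survey of the Hodge conjecture for abelian varieties*, §3 Theorem (proof),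
  7.5–7.7.
* [Mai1989] L. Mai, *Lower bounds for the ranks of CM types*, J. Number Theory 32 (1989), §2 Prop. 1 (proof).
* [Serre1977] J.-P. Serre, *Linear Representations of Finite Groups*, GTM 42, §2.2 Prop. 4; §3.3 (regular representation).
* [Shimura1998] G. Shimura, *Abelian Varieties with Complex Multiplication and Modular Functions*, §8.1.
-/

set_option autoImplicit false

noncomputable section

open scoped BigOperators

universe u v v' w

namespace Summit.HodgeConjecture.CorCM.IrrOdd

open Literature.NumberTheory.ComplexMultiplication

variable {G : Type w} [Group G]

/-! ### §1 The Hecke algebra of a torsor -/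

section Core

variable {Y : Type v'} [Fintype Y] [DecidableEq Y] {Λ : Type*} {Γ : Type*}

omit [Fintype Y] in
/-- Pulling back `δ_{y₀}` along an injective map sending `y` to `y₀` gives `δ_y`. [folklore] -/
theorem single_comp_of_apply_eq (m : Y → Y) (hm : Function.Injective m) {y y₀ : Y} (hy : m y = y₀) (c : ℚ) :
    (fun y' => (Pi.single y₀ c : Y → ℚ) (m y')) = Pi.single y c := by
  funext y'
  have hiff : m y' = y₀ ↔ y' = y := ⟨fun h => hm (h.trans hy.symm), fun h => h ▸ hy⟩
  simp only [Pi.single_apply, hiff]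

/-- **OPERATORS COMMUTING WITH A TRANSITIVE FAMILY ARE COMBINATIONS OF A COVERING COMMUTING FAMILY.**  Let injective
maps `p_λ : Y → Y` move every point to `y₀` (`∀ y ∃ λ, p_λ y = y₀`), and injective maps `q_σ : Y → Y` commute with every
`p_λ` and also move every point to `y₀`.  A linear `α : ℚ^Y → ℚ^Y` commuting with all pull-backs `p_λ^*` is a
ℚ-combination of the pull-backs `q_τ^*`: `α(f) = Σ_y c_y · (f ∘ q_{τ_y})` with `c = α(δ_{y₀})` and `q_{τ_y} y = y₀`.
(For a group `Γ` acting simply transitively and `G` acting through the commuting "left" structure this is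
`End_G(ℚ[Γ]) = ℚ[Γ]^{op}`.) [cite: Serre1977, §3.3 and §2.2 Prop. 4] -/
theorem exists_sum_precomp_of_commute (p : Λ → Y → Y) (q : Γ → Y → Y)
    (hpq : ∀ (l : Λ) (σ : Γ) (y : Y), q σ (p l y) = p l (q σ y))
    (hpinj : ∀ l, Function.Injective (p l)) (hqinj : ∀ σ, Function.Injective (q σ)) (y₀ : Y)
    (hcov : ∀ y, ∃ σ, q σ y = y₀) (htrans : ∀ y, ∃ l, p l y = y₀)
    (α : (Y → ℚ) →ₗ[ℚ] (Y → ℚ)) (hα : ∀ (l : Λ) (f : Y → ℚ), α (fun y => f (p l y)) = fun y => α f (p l y)) :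
    ∃ (c : Y → ℚ) (τ : Y → Γ), ∀ f : Y → ℚ, α f = ∑ y, c y • fun y' => f (q (τ y) y') := by
  choose τ hτ using hcov
  refine ⟨α (Pi.single y₀ 1), τ, fun f => ?_⟩
  -- the candidate operator `A = Σ_y c_y q_{τ_y}^*`
  let A : (Y → ℚ) →ₗ[ℚ] (Y → ℚ) := ∑ y, α (Pi.single y₀ 1) y • LinearMap.funLeft ℚ ℚ (q (τ y))
  have hA : ∀ f, A f = ∑ y, α (Pi.single y₀ 1) y • fun y' => f (q (τ y) y') := fun f => by
    simp only [A, LinearMap.coe_sum, Finset.sum_apply, LinearMap.smul_apply]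
    rfl
  rw [← hA]
  -- `A` commutes with the `p_λ^*`
  have hAp : ∀ (l : Λ) (f : Y → ℚ), A (fun y => f (p l y)) = fun y => A f (p l y) := fun l f => by
    rw [hA, hA]
    funext y
    simp only [Finset.sum_apply, Pi.smul_apply, smul_eq_mul, hpq]
  -- `α` and `A` agree on `δ_{y₀}`
  have h0 : α (Pi.single y₀ 1) = A (Pi.single y₀ 1) := by
    rw [hA]
    funext y'
    simp only [Finset.sum_apply, Pi.smul_apply, smul_eq_mul]
    have h1 : ∀ y, (Pi.single y₀ (1 : ℚ) : Y → ℚ) (q (τ y) y') = (Pi.single y (1 : ℚ) : Y → ℚ) y' := fun y =>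
      congrFun (single_comp_of_apply_eq (q (τ y)) (hqinj (τ y)) (hτ y) 1) y'
    simp only [h1, Pi.single_apply, mul_ite, mul_one, mul_zero, Finset.sum_ite_eq, Finset.mem_univ, if_true]
  -- hence on every basis vector
  have hαA : α = A := by
    refine LinearMap.pi_ext fun y x => ?_
    obtain ⟨l, hl⟩ := htrans y
    have hdec : (Pi.single y x : Y → ℚ) = x • (Pi.single y 1 : Y → ℚ) := by
      funext z
      simp only [Pi.single_apply, Pi.smul_apply, smul_eq_mul, mul_ite, mul_one, mul_zero]
    rw [hdec, map_smul, map_smul, ← single_comp_of_apply_eq (p l) (hpinj l) hl 1, hα, hAp, h0]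
  rw [hαA]

/-- Membership form: such an `α` maps every `f` into the span of its pull-backs `f ∘ q_σ`. [cite: Serre1977, §3.3] -/
theorem apply_mem_span_precomp_of_commute (p : Λ → Y → Y) (q : Γ → Y → Y)
    (hpq : ∀ (l : Λ) (σ : Γ) (y : Y), q σ (p l y) = p l (q σ y))
    (hpinj : ∀ l, Function.Injective (p l)) (hqinj : ∀ σ, Function.Injective (q σ)) (y₀ : Y)
    (hcov : ∀ y, ∃ σ, q σ y = y₀) (htrans : ∀ y, ∃ l, p l y = y₀)
    (α : (Y → ℚ) →ₗ[ℚ] (Y → ℚ)) (hα : ∀ (l : Λ) (f : Y → ℚ), α (fun y => f (p l y)) = fun y => α f (p l y))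
    (f : Y → ℚ) : α f ∈ Submodule.span ℚ (Set.range fun σ : Γ => fun y => f (q σ y)) := by
  obtain ⟨c, τ, hατ⟩ := exists_sum_precomp_of_commute p q hpq hpinj hqinj y₀ hcov htrans α hα
  rw [hατ]
  exact Submodule.sum_mem _ fun y _ => Submodule.smul_mem _ _ (Submodule.subset_span ⟨τ y, rfl⟩)

variable [MulAction G Y]

/-- **THE HECKE ALGEBRA OF A TORSOR.**  `G` transitive on `Y`, `q_σ` injective maps commuting with `G` and covering `Y`
from `y₀`: every `G`-equivariant endomorphism `α` of `ℚ^Y` maps `f` into `span{f ∘ q_σ : σ}` — `End_G(ℚ^Y)` is spanned by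
the pull-backs `q_σ^*`.  (`Y = Hom(M, ℂ)`, `M` normal: the pre-compositions `f ↦ f(· ∘ δ)`, `δ ∈ Aut(M)`.)
[cite: Serre1977, §3.3 and §2.2 Prop. 4] [cite: Shimura1998, §8.1] -/
theorem apply_mem_span_precomp (q : Γ → Y → Y) (hq : ∀ (σ : Γ) (g : G) (y : Y), q σ (g • y) = g • q σ y)
    (hqinj : ∀ σ, Function.Injective (q σ)) (y₀ : Y) (hcov : ∀ y, ∃ σ, q σ y = y₀)
    (htrans : ∀ y : Y, ∃ g : G, g • y = y₀) (α : (Y → ℚ) →ₗ[ℚ] (Y → ℚ))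
    (hα : ∀ (g : G) (f : Y → ℚ), α (fun y => f (g⁻¹ • y)) = fun y => α f (g⁻¹ • y)) (f : Y → ℚ) :
    α f ∈ Submodule.span ℚ (Set.range fun σ : Γ => fun y => f (q σ y)) :=
  apply_mem_span_precomp_of_commute (fun (g : G) (y : Y) => g⁻¹ • y) q (fun g σ y => hq σ g⁻¹ y)
    (fun g => MulAction.injective g⁻¹) hqinj y₀ hcov
    (fun y => by
      obtain ⟨g, hg⟩ := htrans y
      exact ⟨g⁻¹, by rw [inv_inv]; exact hg⟩)
    α hα f

omit [Fintype Y] [DecidableEq Y] in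
/-- Conversely every element of `span{f ∘ q_σ}` is `β(f)` for a `G`-equivariant `β = Σ c_k q_{σ_k}^*` (the pull-backs
commute with `G`). [cite: Shimura1998, §8.1] -/
theorem exists_equivariant_of_mem_span_precomp (q : Γ → Y → Y)
    (hq : ∀ (σ : Γ) (g : G) (y : Y), q σ (g • y) = g • q σ y) {f x : Y → ℚ}
    (hx : x ∈ Submodule.span ℚ (Set.range fun σ : Γ => fun y => f (q σ y))) :
    ∃ β : (Y → ℚ) →ₗ[ℚ] (Y → ℚ), (∀ (g : G) (h : Y → ℚ), β (fun y => h (g⁻¹ • y)) = fun y => β h (g⁻¹ • y)) ∧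
      β f = x := by
  induction hx using Submodule.span_induction with
  | mem x hx =>
    obtain ⟨σ, rfl⟩ := hx
    refine ⟨LinearMap.funLeft ℚ ℚ (q σ), fun g h => ?_, rfl⟩
    funext y
    simp only [LinearMap.funLeft_apply, hq]
  | zero => exact ⟨0, fun g h => by funext y; rfl, by simp⟩
  | add x x' _ _ hx hx' =>
    obtain ⟨β, hβ, hβf⟩ := hx
    obtain ⟨β', hβ', hβf'⟩ := hx'
    refine ⟨β + β', fun g h => ?_, by simp [hβf, hβf']⟩
    rw [LinearMap.add_apply, LinearMap.add_apply, hβ g h, hβ' g h]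
    funext y
    rfl
  | smul c x _ hx =>
    obtain ⟨β, hβ, hβf⟩ := hx
    refine ⟨c • β, fun g h => ?_, by simp [hβf]⟩
    rw [LinearMap.smul_apply, LinearMap.smul_apply, hβ g h]
    funext y
    rfl

end Core

/-! ### §2 The Hecke criterion -/

section Criterion

variable {I : Type u} {E : I → Type v} [∀ i, MulAction G (E i)] [DecidableEq I] [Fintype I] [∀ i, Fintype (E i)]
  [Nonempty I] [∀ i, Nonempty (E i)] {Y : Type v'} [MulAction G Y] [Fintype Y] [DecidableEq Y] {Γ : Type*}

omit [Fintype Y] in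
/-- **A COMMON NON-ZERO HECKE COMBINATION OF THE SHADOWS OBSTRUCTS ADDITIVITY** (only the commutation of the `q_σ` with
`G` is used; no hypothesis on fibres): if `span{w₀ ∘ q_σ} ∩ span{w₁ ∘ q_σ} ≠ 0` then
`rank(Σ) + |I| < Σ_i rank(Φ_i) + 1`. [cite: Gordon1999HodgeAVSurvey, §3 Theorem (proof) and 7.5] -/
theorem typeRank_sigmaType_add_card_lt_of_span_precomp_inf_ne_bot {ρ : G} {Φ : ∀ i, Set (E i)}
    (h : ∀ i, IsCMTypeWith ρ (Φ i)) {i₀ i₁ : I} (h01 : i₀ ≠ i₁) (r₀ : E i₀ → Y) (r₁ : E i₁ → Y)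
    (hr₀ : ∀ (g : G) (x : E i₀), r₀ (g • x) = g • r₀ x) (hr₁ : ∀ (g : G) (x : E i₁), r₁ (g • x) = g • r₁ x)
    (q : Γ → Y → Y) (hq : ∀ (σ : Γ) (g : G) (y : Y), q σ (g • y) = g • q σ y)
    (hne : Submodule.span ℚ (Set.range fun σ : Γ => fun y =>
        ∑ x ∈ Finset.univ.filter (fun x => r₀ x = q σ y), antiVec (Φ i₀) (1 : G) x) ⊓
      Submodule.span ℚ (Set.range fun σ : Γ => fun y =>
        ∑ x ∈ Finset.univ.filter (fun x => r₁ x = q σ y), antiVec (Φ i₁) (1 : G) x) ≠ ⊥) :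
    typeRank G (sigmaType Φ) + Fintype.card I < (∑ i, typeRank G (Φ i)) + 1 := by
  obtain ⟨x, ⟨hx₀, hx₁⟩, hx⟩ := (Submodule.ne_bot_iff _).1 hne
  obtain ⟨α, hα, hαw⟩ := exists_equivariant_of_mem_span_precomp (G := G) q hq
    (f := fun y => ∑ x ∈ Finset.univ.filter (fun x => r₀ x = y), antiVec (Φ i₀) (1 : G) x) hx₀
  obtain ⟨β, hβ, hβw⟩ := exists_equivariant_of_mem_span_precomp (G := G) q hq
    (f := fun y => ∑ x ∈ Finset.univ.filter (fun x => r₁ x = y), antiVec (Φ i₁) (1 : G) x) hx₁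
  exact typeRank_sigmaType_add_card_lt_of_shadow_collision h h01 r₀ r₁ hr₀ hr₁ (fun g (f : Y → ℚ) y => f (g⁻¹ • y))
    α β hα hβ (hαw.trans hβw.symm) (by rw [hαw]; exact hx)

/-- **THE HECKE CRITERION.**  Two-slot family of CM types; pivot `Y` with equivariant surjections `r_κ`, fibre-transitive
`N ⊆ ⟨pointwise stabilisers⟩` (S1 (H1)–(H3)); `G` transitive on `Y`; injective `q_σ : Y → Y` commuting with `G` and
covering `Y` from `y₀`.  Then `rank(Φ₀, Φ₁) + 2 = rank Φ₀ + rank Φ₁ + 1` (`Hg(A₀ × A₁) = Hg(A₀) × Hg(A₁)`) **iff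
`span{w₀ ∘ q_σ : σ} ∩ span{w₁ ∘ q_σ : σ} = 0`** — the right ideals generated by the two shadows in `ℚ[Γ] ≅ ℚ^Y` meet in
`0`. [cite: Gordon1999HodgeAVSurvey, §3 Theorem and 7.5–7.7] [cite: Mai1989, §2 Prop. 1 (proof)] [cite: Serre1977, §3.3] -/
theorem typeRank_sigmaType_add_card_eq_iff_span_precomp_inf_eq_bot {ρ : G} {Φ : ∀ i, Set (E i)}
    (h : ∀ i, IsCMTypeWith ρ (Φ i)) {i₀ i₁ : I} (hI : ∀ j, j = i₀ ∨ j = i₁) (h01 : i₀ ≠ i₁)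
    (r₀ : E i₀ → Y) (r₁ : E i₁ → Y)
    (hr₀ : ∀ (g : G) (x : E i₀), r₀ (g • x) = g • r₀ x) (hr₁ : ∀ (g : G) (x : E i₁), r₁ (g • x) = g • r₁ x)
    (hs₀ : Function.Surjective r₀) (hs₁ : Function.Surjective r₁) (N : Set G)
    (hN₀ : ∀ x x' : E i₀, r₀ x = r₀ x' → ∃ n ∈ N, n • x = x')
    (hN₁ : ∀ x x' : E i₁, r₁ x = r₁ x' → ∃ n ∈ N, n • x = x')
    (hNcl : N ⊆ Subgroup.closure ({g : G | ∀ x : E i₀, g • x = x} ∪ {g : G | ∀ x : E i₁, g • x = x}))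
    (q : Γ → Y → Y) (hq : ∀ (σ : Γ) (g : G) (y : Y), q σ (g • y) = g • q σ y)
    (hqinj : ∀ σ, Function.Injective (q σ)) (y₀ : Y) (hcov : ∀ y, ∃ σ, q σ y = y₀)
    (htrans : ∀ y : Y, ∃ g : G, g • y = y₀) :
    typeRank G (sigmaType Φ) + Fintype.card I = (∑ i, typeRank G (Φ i)) + 1 ↔
      Submodule.span ℚ (Set.range fun σ : Γ => fun y =>
          ∑ x ∈ Finset.univ.filter (fun x => r₀ x = q σ y), antiVec (Φ i₀) (1 : G) x) ⊓
        Submodule.span ℚ (Set.range fun σ : Γ => fun y =>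
          ∑ x ∈ Finset.univ.filter (fun x => r₁ x = q σ y), antiVec (Φ i₁) (1 : G) x) = ⊥ := by
  refine ⟨fun hEq => ?_, fun hbot => ?_⟩
  · by_contra hne
    exact absurd hEq (ne_of_lt (typeRank_sigmaType_add_card_lt_of_span_precomp_inf_ne_bot h h01 r₀ r₁ hr₀ hr₁
      q hq hne))
  · refine (typeRank_sigmaType_add_card_eq_iff_not_exists_shadow_collision h hI h01 r₀ r₁ hr₀ hr₁ hs₀ hs₁ N hN₀
      hN₁ hNcl).2 ?_
    rintro ⟨α, β, hα, hβ, heq, hne⟩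
    apply hne
    have hα' := apply_mem_span_precomp q hq hqinj y₀ hcov htrans α hα
      (fun y => ∑ x ∈ Finset.univ.filter (fun x => r₀ x = y), antiVec (Φ i₀) (1 : G) x)
    have hβ' := apply_mem_span_precomp q hq hqinj y₀ hcov htrans β hβ
      (fun y => ∑ x ∈ Finset.univ.filter (fun x => r₁ x = y), antiVec (Φ i₁) (1 : G) x)
    rw [← heq] at hβ'
    have hmem := Submodule.mem_inf.2 ⟨hα', hβ'⟩
    rw [hbot, Submodule.mem_bot] at hmem
    exact hmem

/-- **Nondegeneracy form of the Hecke criterion**: with `span{w₀ ∘ q_σ} ∩ span{w₁ ∘ q_σ} = 0`, `Σ` is nondegenerate iff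
both members are. [cite: Gordon1999HodgeAVSurvey, §3 Theorem (2) and 7.5–7.6.1] -/
theorem typeRank_sigmaType_eq_iff_forall_of_span_precomp_inf_eq_bot {ρ : G} {Φ : ∀ i, Set (E i)}
    (h : ∀ i, IsCMTypeWith ρ (Φ i)) {i₀ i₁ : I} (hI : ∀ j, j = i₀ ∨ j = i₁) (h01 : i₀ ≠ i₁)
    (r₀ : E i₀ → Y) (r₁ : E i₁ → Y)
    (hr₀ : ∀ (g : G) (x : E i₀), r₀ (g • x) = g • r₀ x) (hr₁ : ∀ (g : G) (x : E i₁), r₁ (g • x) = g • r₁ x)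
    (hs₀ : Function.Surjective r₀) (hs₁ : Function.Surjective r₁) (N : Set G)
    (hN₀ : ∀ x x' : E i₀, r₀ x = r₀ x' → ∃ n ∈ N, n • x = x')
    (hN₁ : ∀ x x' : E i₁, r₁ x = r₁ x' → ∃ n ∈ N, n • x = x')
    (hNcl : N ⊆ Subgroup.closure ({g : G | ∀ x : E i₀, g • x = x} ∪ {g : G | ∀ x : E i₁, g • x = x}))
    (q : Γ → Y → Y) (hq : ∀ (σ : Γ) (g : G) (y : Y), q σ (g • y) = g • q σ y)
    (hqinj : ∀ σ, Function.Injective (q σ)) (y₀ : Y) (hcov : ∀ y, ∃ σ, q σ y = y₀)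
    (htrans : ∀ y : Y, ∃ g : G, g • y = y₀)
    (hbot : Submodule.span ℚ (Set.range fun σ : Γ => fun y =>
          ∑ x ∈ Finset.univ.filter (fun x => r₀ x = q σ y), antiVec (Φ i₀) (1 : G) x) ⊓
        Submodule.span ℚ (Set.range fun σ : Γ => fun y =>
          ∑ x ∈ Finset.univ.filter (fun x => r₁ x = q σ y), antiVec (Φ i₁) (1 : G) x) = ⊥) :
    typeRank G (sigmaType Φ) = Fintype.card (Σ i, E i) / 2 + 1 ↔
      ∀ i, typeRank G (Φ i) = Fintype.card (E i) / 2 + 1 := by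
  have hEq := (typeRank_sigmaType_add_card_eq_iff_span_precomp_inf_eq_bot h hI h01 r₀ r₁ hr₀ hr₁ hs₀ hs₁ N hN₀ hN₁
    hNcl q hq hqinj y₀ hcov htrans).2 hbot
  exact typeRank_sigmaType_eq_iff_forall_of_forall_map_le h
    ((forall_map_slotExt_le_iff_typeRank_sigmaType_add_card_eq h).2 hEq)

end Criterion

end Summit.HodgeConjecture.CorCM.IrrOdd

end
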